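import Mathlib
import HarnessLib
import Summits.Ventures.LatticeQCDFlow.Exactness.FrozenExteriorESS
import Summits.Ventures.LatticeQCDFlow.Scaling.ImportanceWeights

/-!
# Frozen exterior: the penalty is `KL(π₀^ext‖π₁^ext)`, the Kish ceiling is `e^{−D₂(π₁^ext‖π₀^ext)}`

HONEST FRAMING: exact (Metropolis-corrected) sampling algorithms for lattice gauge theory;
figures of merit are autocorrelation/cost numbers at stated couplings and volumes; no
continuum-physics claim.

Venture `LatticeQCDFlow` (cell pub-lqcd), topic `Exactness`; FANOUT row 8 (`s0-cpn-nemc`, GEN-7).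
NEW WORK of the cell (elementary finite sums), not a published result; nothing is cited as a fact.
Companions: row 13's `Exactness/FrozenExteriorPenalty.lean` (first-moment half: `quenchedMean`,
`annealedDeltaF`, `frozenExteriorPenalty`), row 8's `Exactness/FrozenExteriorESS.lean` (second-moment
half: `mixtureKish`, `frozenExteriorEssCeiling`), theory-2's `Scaling/ImportanceWeights.lean`
(`weight`, `essFrac`, `klFin`, T2-A `essFrac_le_exp_neg_kl`).

## Content

With prior exterior weights `p` (a probability vector) and conditional free-energy differences `ΔF`,
the TARGET marginal of the exterior is
`exteriorTarget p ΔF (y) = p_y e^{−ΔF(y)} / Σ_{y'} p_{y'} e^{−ΔF(y')} = p_y e^{annealedDeltaF − ΔF(y)}`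
(`exteriorTarget_eq`; for the defect protocol `p_y = Z₀(y)/Z₀` and `π₁^ext(y) = Z₁(y)/Z₁`).  Then,
for a positive prior marginal:

* **`frozenExteriorEssCeiling_eq_essFrac`** — the Kish ceiling of `FrozenExteriorESS.lean` IS
  theory-2's ESS fraction of the exterior target marginal against the prior one,
  `frozenExteriorEssCeiling p ΔF = essFrac π₁^ext π₀^ext`; in `χ²` / Rényi-2 form
  `= (Σ_y π₁^ext(y)²/p_y)⁻¹ = 1/(1 + χ²(π₁^ext‖π₀^ext)) = e^{−D₂(π₁^ext‖π₀^ext)}`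
  (`frozenExteriorEssCeiling_eq_inv`), hence **`frozenExteriorEssCeiling_le_exp_neg_kl`**:
  ceiling `≤ e^{−KL(π₁^ext‖π₀^ext)}` (T2-A);
* **`frozenExteriorPenalty_eq_klFin`** — row 13's first-moment penalty IS the Kullback–Leibler
  divergence `KL(π₀^ext‖π₁^ext)` of the PRIOR exterior marginal from the TARGET one (the wording of
  the flow seat's `BALL-FLOOR-flow.md` §1, `Q := KL(π₀^ext‖π₁^ext) = E_yΔF(y) − ΔF`, as a theorem);
  `klFin_exteriorTarget_eq` gives the other direction `KL(π₁^ext‖π₀^ext) = annealedDeltaF − ⟨ΔF⟩_{π₁}`,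
  and the two add up to the Jeffreys divergence `⟨ΔF⟩_{π₀^ext} − ⟨ΔF⟩_{π₁^ext}`
  (`penalty_add_klFin_exteriorTarget`);
* **`mixtureKish_le_exp_neg_kl_of_jarzynski`** — the packaged statement: for a frozen exterior with
  positive prior marginal and per-exterior Jarzynski, the Kish-ESS fraction of the path weights
  `e^{−W}` is at most `e^{−KL(π₁^ext‖π₀^ext)}`, for every number of steps and every exterior-freezing
  interior kernel.

Reading (flow seat BALL-FLOOR-flow.md §2, exact 2-d U(1) mirror; theirs, quoted): `D₂/Q ∈ [0.8, 2.0]`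
there, so `e^{−2Q}` is a Gaussian-regime reading of the ceiling, not a bound; the bound is `e^{−D₂}`
(and, weaker, `e^{−KL(π₁^ext‖π₀^ext)}`).  The two KL directions are in general not comparable.
-/

namespace Summit.Ventures.LatticeQCDFlow.Exactness

open Finset Real
open Summit.Ventures.LatticeQCDFlow.Theory2 (weight essFrac klFin essFrac_eq_inv
  essFrac_le_exp_neg_kl mul_weight_eq_sq_div)

section FrozenExteriorMarginals

variable {Y : Type*} [Fintype Y] {Ω : Type*} [Fintype Ω]

/-- The TARGET marginal of the exterior, `π₁^ext(y) = p_y e^{−ΔF(y)} / Σ_{y'} p_{y'} e^{−ΔF(y')}`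
(for the defect protocol: `p_y = Z₀(y)/Z₀` is the prior marginal and `π₁^ext(y) = Z₁(y)/Z₁`). -/
noncomputable def exteriorTarget (p dF : Y → ℝ) (y : Y) : ℝ :=
  p y * Real.exp (-dF y) / ∑ y', p y' * Real.exp (-dF y')

/-- `π₁^ext(y) = p_y · e^{annealedDeltaF − ΔF(y)}`. -/
theorem exteriorTarget_eq {p dF : Y → ℝ} (hp : ∀ y, 0 ≤ p y) (hsum : ∑ y, p y = 1) (y : Y) :
    exteriorTarget p dF y = p y * Real.exp (annealedDeltaF p dF - dF y) := by
  have hpos := mixtureSum_pos (dF := dF) hp hsum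
  have hZ : Real.exp (-annealedDeltaF p dF) = ∑ y', p y' * Real.exp (-dF y') := by
    unfold annealedDeltaF; rw [neg_neg, Real.exp_log hpos]
  unfold exteriorTarget
  rw [← hZ, Real.exp_neg (annealedDeltaF p dF), div_inv_eq_mul, sub_eq_add_neg, Real.exp_add]
  ring

/-- The exterior target marginal is a probability vector: it sums to one. -/
theorem sum_exteriorTarget {p dF : Y → ℝ} (hp : ∀ y, 0 ≤ p y) (hsum : ∑ y, p y = 1) :
    ∑ y, exteriorTarget p dF y = 1 := by
  have hpos := mixtureSum_pos (dF := dF) hp hsum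
  unfold exteriorTarget
  rw [← Finset.sum_div, div_self hpos.ne']

/-- The exterior target marginal is non-negative. -/
theorem exteriorTarget_nonneg {p dF : Y → ℝ} (hp : ∀ y, 0 ≤ p y) (hsum : ∑ y, p y = 1) (y : Y) :
    0 ≤ exteriorTarget p dF y :=
  div_nonneg (mul_nonneg (hp y) (Real.exp_pos _).le) (mixtureSum_pos (dF := dF) hp hsum).le

/-- The exterior target marginal is positive where the prior marginal is. -/
theorem exteriorTarget_pos {p dF : Y → ℝ} (hp : ∀ y, 0 ≤ p y) (hsum : ∑ y, p y = 1) {y : Y}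
    (hy : 0 < p y) : 0 < exteriorTarget p dF y :=
  div_pos (mul_pos hy (Real.exp_pos _)) (mixtureSum_pos (dF := dF) hp hsum)

/-- The importance weight of the target against the prior exterior marginal is
`e^{−ΔF(y)} / Σ p e^{−ΔF}` wherever `p_y ≠ 0`. -/
theorem weight_exteriorTarget {p dF : Y → ℝ} {y : Y} (hy : p y ≠ 0) :
    weight (exteriorTarget p dF) p y = Real.exp (-dF y) / ∑ y', p y' * Real.exp (-dF y') := by
  unfold weight exteriorTarget
  field_simp

/-- **THE CEILING IS THEORY-2's ESS FRACTION** of the exterior target marginal against the prior one: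
`frozenExteriorEssCeiling p ΔF = essFrac π₁^ext π₀^ext` (for a positive prior marginal). -/
theorem frozenExteriorEssCeiling_eq_essFrac {p dF : Y → ℝ} (hp : ∀ y, 0 < p y)
    (hsum : ∑ y, p y = 1) :
    frozenExteriorEssCeiling p dF = essFrac (exteriorTarget p dF) p := by
  have hp' : ∀ y, 0 ≤ p y := fun y => (hp y).le
  have hpos := mixtureSum_pos (dF := dF) hp' hsum
  set Z := ∑ y', p y' * Real.exp (-dF y') with hZ
  have hw : ∀ y, weight (exteriorTarget p dF) p y = Real.exp (-dF y) / Z :=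
    fun y => weight_exteriorTarget (hp y).ne'
  unfold essFrac frozenExteriorEssCeiling
  simp only [hw]
  have h1 : ∑ y, p y * (Real.exp (-dF y) / Z) = 1 := by
    simp_rw [mul_div_assoc']
    rw [← Finset.sum_div, ← hZ]
    exact div_self hpos.ne'
  have h2 : ∑ y, p y * (Real.exp (-dF y) / Z) ^ 2
      = (∑ y, p y * Real.exp (-dF y) ^ 2) / Z ^ 2 := by
    rw [Finset.sum_div]
    refine Finset.sum_congr rfl fun y _ => ?_
    rw [div_pow]; ring
  rw [h1, h2, ← hZ, one_pow, one_div, inv_div]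

/-- The ceiling in `χ²` / Rényi-2 form: `frozenExteriorEssCeiling = (Σ_y π₁^ext(y)²/p_y)⁻¹ =
1/(1 + χ²(π₁^ext‖π₀^ext)) = e^{−D₂(π₁^ext‖π₀^ext)}` (theory-2's `essFrac_eq_inv`). -/
theorem frozenExteriorEssCeiling_eq_inv {p dF : Y → ℝ} (hp : ∀ y, 0 < p y) (hsum : ∑ y, p y = 1) :
    frozenExteriorEssCeiling p dF = (∑ y, exteriorTarget p dF y ^ 2 / p y)⁻¹ := by
  have hp' : ∀ y, 0 ≤ p y := fun y => (hp y).le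
  rw [frozenExteriorEssCeiling_eq_essFrac hp hsum, essFrac_eq_inv hp (sum_exteriorTarget hp' hsum)]
  congr 1
  exact Finset.sum_congr rfl fun y _ => mul_weight_eq_sq_div _ _ y

/-- **CEILING ≤ e^{−KL(π₁^ext‖π₀^ext)}** (theory-2's T2-A `essFrac_le_exp_neg_kl` applied to the
exterior marginals). -/
theorem frozenExteriorEssCeiling_le_exp_neg_kl {p dF : Y → ℝ} (hp : ∀ y, 0 < p y)
    (hsum : ∑ y, p y = 1) :
    frozenExteriorEssCeiling p dF ≤ Real.exp (-klFin (exteriorTarget p dF) p) := by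
  have hp' : ∀ y, 0 ≤ p y := fun y => (hp y).le
  rw [frozenExteriorEssCeiling_eq_essFrac hp hsum]
  exact essFrac_le_exp_neg_kl (fun y => exteriorTarget_pos hp' hsum (hp y)) hp
    (sum_exteriorTarget hp' hsum)

/-- **THE FIRST-MOMENT PENALTY IS A KULLBACK–LEIBLER DIVERGENCE**: row 13's
`frozenExteriorPenalty p ΔF = Σ_y p_y ΔF(y) − annealedDeltaF` equals `KL(π₀^ext‖π₁^ext)`, the
divergence of the PRIOR exterior marginal from the TARGET one (for a positive prior marginal). -/
theorem frozenExteriorPenalty_eq_klFin {p dF : Y → ℝ} (hp : ∀ y, 0 < p y) (hsum : ∑ y, p y = 1) :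
    frozenExteriorPenalty p dF = klFin p (exteriorTarget p dF) := by
  have hp' : ∀ y, 0 ≤ p y := fun y => (hp y).le
  unfold klFin frozenExteriorPenalty quenchedMean
  have hlog : ∀ y, Real.log (p y / exteriorTarget p dF y) = dF y - annealedDeltaF p dF := by
    intro y
    rw [exteriorTarget_eq hp' hsum y]
    have hpy : p y ≠ 0 := (hp y).ne'
    rw [div_mul_eq_div_div, div_self hpy, one_div, Real.log_inv, Real.log_exp]
    ring
  simp only [hlog, mul_sub, Finset.sum_sub_distrib, ← Finset.sum_mul, hsum, one_mul]

/-- The other direction: `KL(π₁^ext‖π₀^ext) = annealedDeltaF − ⟨ΔF⟩_{π₁^ext}`. -/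
theorem klFin_exteriorTarget_eq {p dF : Y → ℝ} (hp : ∀ y, 0 < p y) (hsum : ∑ y, p y = 1) :
    klFin (exteriorTarget p dF) p
      = annealedDeltaF p dF - ∑ y, exteriorTarget p dF y * dF y := by
  have hp' : ∀ y, 0 ≤ p y := fun y => (hp y).le
  unfold klFin
  have hlog : ∀ y, Real.log (exteriorTarget p dF y / p y) = annealedDeltaF p dF - dF y := by
    intro y
    rw [exteriorTarget_eq hp' hsum y]
    have hpy : p y ≠ 0 := (hp y).ne'
    rw [mul_div_right_comm, div_self hpy, one_mul]
    exact Real.log_exp _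
  simp only [hlog, mul_sub, Finset.sum_sub_distrib, ← Finset.sum_mul, sum_exteriorTarget hp' hsum,
    one_mul]

/-- The two directions add up to the Jeffreys divergence of the exterior marginals,
`Q + KL(π₁^ext‖π₀^ext) = ⟨ΔF⟩_{π₀^ext} − ⟨ΔF⟩_{π₁^ext}`. -/
theorem penalty_add_klFin_exteriorTarget {p dF : Y → ℝ} (hp : ∀ y, 0 < p y)
    (hsum : ∑ y, p y = 1) :
    frozenExteriorPenalty p dF + klFin (exteriorTarget p dF) p
      = quenchedMean p dF - ∑ y, exteriorTarget p dF y * dF y := by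
  rw [klFin_exteriorTarget_eq hp hsum]
  unfold frozenExteriorPenalty
  ring

/-- **PACKAGED STATEMENT.**  For a frozen exterior with positive prior marginal `p` and per-exterior
Jarzynski, the Kish-ESS fraction of the path weights `e^{−W}` is at most
`e^{−KL(π₁^ext‖π₀^ext)}` — for every number of steps and every exterior-freezing interior kernel. -/
theorem mixtureKish_le_exp_neg_kl_of_jarzynski {p : Y → ℝ} {q W : Y → Ω → ℝ} {dF : Y → ℝ}
    (hp : ∀ y, 0 < p y) (hsum : ∑ y, p y = 1) (hq : ∀ y ω, 0 ≤ q y ω)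
    (hqs : ∀ y, ∑ ω, q y ω = 1)
    (hJ : ∀ y, ∑ ω, q y ω * Real.exp (-W y ω) = Real.exp (-dF y)) :
    mixtureKish p q (fun y ω => Real.exp (-W y ω))
      ≤ Real.exp (-klFin (exteriorTarget p dF) p) :=
  (mixtureKish_le_ceiling_of_jarzynski (fun y => (hp y).le) hq hqs hJ).trans
    (frozenExteriorEssCeiling_le_exp_neg_kl hp hsum)

end FrozenExteriorMarginals

end Summit.Ventures.LatticeQCDFlow.Exactness
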